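import Literature.NumberTheory.Automorphic.UnitaryGroupRankOneIwasawa
import HarnessLib

/-!
# The quasi-split `U(3)` over a valued field with ANY isometric involution — III: THE CARTAN DECOMPOSITION
# `U(σ, Φ₃)(K) = ⋃ₙ K₀ · d(ϖ,1,(σϖ)⁻¹)ⁿ · K₀ · Z(U)` (ramified quadratic `K/K^σ`, residue characteristic `2` included)

Topic `NumberTheory/Automorphic`; namespace `Literature.NumberTheory.Automorphic.UnitaryGroup`.  THEOREMS ONLY (no `def`, no `instance`,
no notation, no named fact, no `sorry`; axioms ⊆ {propext, Classical.choice, Quot.sound}).  File 3 of 3 of road (δ) «ELEMENTARY CARTAN for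
ANY quadratic `σ`» (cell `pub/hodgecm-mathlib` (D-0151), crux `H413` = `stmt-HodgeConjecture-24833`, programme P2, desk F0P2-plan (g8) «=»
2026-08-31T18:06Z, interface frozen 18:08:26Z; seat B-p17 (g21)); continues ★ `UnitaryGroupRankOneIwasawa`.

THE POINT.  ★ `UnitaryGroupRogawskiTorusCartanForm.exists_comap_glInt_mul_torus_mul` (A-p16, p830333) gives the Cartan decomposition of
`U(σ, Φ₃)(K)` along the `σ`-FIXED ray `d(ϖ, 1, ϖ⁻¹)` under ★ `HermitianLattice.UnramifiedLocalConjDatum` — i.e. only when `K/K^σ` is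
UNRAMIFIED (a `σ`-fixed uniformiser exists).  At a RAMIFIED place the `σ`-fixed ray `d(ϖ_F, 1, ϖ_F⁻¹)` has DEFECT 2 (`d(ϖ_E, 1, (σϖ_E)⁻¹) ∉
K₀ · d(ϖ_F,1,ϖ_F⁻¹)^ℕ · K₀` by elementary divisors), and no Bruhat–Tits datum for ramified hermitian lattices is in the tree.  Here the ray is
`a = d(ϖ, 1, (σϖ)⁻¹)` for ANY uniformiser `ϖ` of `K` (matrix-pinned: `ha : a = Matrix.diagonal ![ϖ, 1, (σ ϖ)⁻¹]`, no new definition), and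
the proof is ELEMENTARY: Iwasawa `g = k·(n t)` (file II + ★ `exists_unipotent_mul_torus_of_mem_borelOfForm`), `n t ∈ K₀ T K₀` (file II, via
the rank-one big cell of file I), and `T ⊂ K₀ · a^ℕ · K₀ · Z(U)` (§1 here: `diag(d₀,d₁,d₂) = (d₁·1) · d(γ,1,(σγ)⁻¹)`, `γ = u·ϖ^{∓p}`, and a
NEGATIVE power costs only `K₀`: `a⁻¹ = w₀ · a · w₀ · d(ε,1,ε)` with the unit `ε = σϖ/ϖ`).

* §1 `exists_coe_eq_diagonal_uniformizer` (the ray generator exists in `U`), `mem_torusU_of_coe_eq_diagonal`, **`coe_pow_eq_diagonal`**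
  (`aᵏ = d(ϖᵏ, 1, (σϖ)⁻ᵏ)`), `exists_inv_pow_eq` (`a⁻ᵏ ∈ K₀ aᵏ K₀`), `exists_torus_eq_pow` (`T ⊂ K₀ a^ℕ K₀ Z(U)`).
* §2 **`exists_cartan_of_involution (hσσ) (hσv) (hϖ : Valued.v ϖ = exp(-1)) (a) (ha) (g) :
  ∃ k₁ ∈ K₀, ∃ k₂ ∈ K₀, ∃ n : ℕ, ∃ z ∈ Subgroup.center ↥U, g = k₁ * a ^ n * k₂ * z`** — EXACTLY the `hcartan` socket of ★
  `Representation.isSupercuspidal_of_subsingleton_coinvariants_of_cartan` (★ `JacquetCuspidalCompactCoefficients`) and of ★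
  `isSupercuspidal_of_coinvariants_subsingleton_of_cartan_diagonal` (★ `UnitaryGroupRayJacquetCriterion`, p830719), through which the ⇐ half of
  the printed citation ★ `Rogawski1990.u3_isSupercuspidal_iff_jacquet_eq_zero` becomes a theorem at EVERY non-split place (A-p16's
  `U3JacquetVanishingSupercuspidal`, unramified case ★ p830400).  `ϖ` MUST be a uniformiser: with `|ϖ| < 1` only the statement is false
  (F0P2-ref1 r180, elementary divisors).

HONEST LABEL: HC_CM is proved only modulo the printed citations until rung 0 closes; this file is local structure theory and discharges no
letter by itself (the N6 letter is discharged by its consumer `u3_isSupercuspidal_iff_jacquet_eq_zero_holds`).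

## References
* [Rogawski1990] J. D. Rogawski, *Automorphic Representations of Unitary Groups in Three Variables*, Ann. of Math. Stud. 123 (1990),
  §1.9 p. 8 (the form `Φ` and `U(Φ)`), §1.10 p. 9 (`B = MN`, `N = {u(x, z)}`, `M = {d(α, β, ᾱ⁻¹)}`, the Weyl element), §12.2 p. 173.
* [BruhatTits1972] F. Bruhat, J. Tits, *Groupes réductifs sur un corps local I*, Publ. Math. IHÉS 41 (1972), (4.4.3) (Iwasawa and
  Cartan decompositions `G = K·B`, `G = K·A⁺·K` for a good maximal compact `K`).
* [Tits1979] J. Tits, *Reductive groups over local fields*, Proc. Sympos. Pure Math. 33.1 (1979), §3.3.2–§3.3.3.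
* [Casselman1995] W. Casselman, *Introduction to the theory of admissible representations of `p`-adic reductive groups* (1995 notes),
  Prop. 1.3.1 (rank-one Bruhat cells), Thm. 5.3.1 (Harish-Chandra's criterion — the consumer).
* [PlatonovRapinchuk1994] V. Platonov, A. Rapinchuk, *Algebraic Groups and Number Theory* (1994), §3.3 (`GL_n(𝒪)` and its conjugates).
* [Serre1979] J.-P. Serre, *Local Fields*, GTM 67 (1979), Ch. I §1, Ch. II §1 (discrete valuations, uniformisers, the ultrametric inequality).
-/

set_option autoImplicit false

open scoped MatrixGroups Pointwise Topology WithZero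
open ValuativeRel Matrix

namespace Literature.NumberTheory.Automorphic

namespace UnitaryGroup

/-- `rev 0 = 2` in `Fin 3`. [folklore] -/
private theorem rev0' : Fin.rev (0 : Fin 3) = 2 := rfl

/-- `rev 1 = 1` in `Fin 3`. [folklore] -/
private theorem rev1' : Fin.rev (1 : Fin 3) = 1 := rfl

/-- `rev 2 = 0` in `Fin 3`. [folklore] -/
private theorem rev2' : Fin.rev (2 : Fin 3) = 0 := rfl

/-- A `3 × 3` diagonal matrix written out (private copy). [folklore] -/
private theorem diagonal_three_eq' {K : Type*} [Field K] (p q r : K) : Matrix.diagonal ![p, q, r] = !![p, 0, 0; 0, q, 0; 0, 0, r] := by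
  ext i j
  fin_cases i <;> fin_cases j <;> simp

/-! ## §1 The torus ray `a = d(ϖ, 1, (σϖ)⁻¹)`: powers, inverse, and `T ⊂ K₀ a^ℕ K₀ Z` -/

section Ray

variable {K : Type*} [Field K] [Valued K ℤᵐ⁰] [ValuativeRel K] [(Valued.v : Valuation K ℤᵐ⁰).Compatible]
  (σ : K →+* K) {J : Matrix (Fin 3) (Fin 3) K} (hJ : J = (StdForm.antidiagonal 3).over K) {ϖ : K}

omit [Valued K ℤᵐ⁰] [ValuativeRel K] [(Valued.v : Valuation K ℤᵐ⁰).Compatible] in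
include hJ in
/-- **The torus ray generator exists**: for `ϖ ≠ 0` there is `a ∈ U(σ, Φ₃)` with matrix `d(ϖ, 1, (σϖ)⁻¹)` (Rogawski's
`d(α, β, ᾱ⁻¹)` with `α = ϖ`, `β = 1`; `ϖ` need NOT be `σ`-fixed). [cite: Rogawski1990, §1.10 p. 9] -/
theorem exists_coe_eq_diagonal_uniformizer (hσσ : ∀ x, σ (σ x) = x) (hϖ0 : ϖ ≠ 0) :
    ∃ a : ↥(unitaryGroupOfForm σ J), ((a : GL (Fin 3) K) : Matrix (Fin 3) (Fin 3) K) = Matrix.diagonal ![ϖ, 1, (σ ϖ)⁻¹] := by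
  obtain ⟨a, -, ha⟩ := exists_coe_eq_diag σ hJ hσσ hϖ0 (β := 1) (by rw [map_one, mul_one])
  refine ⟨a, ?_⟩
  rw [ha]
  ext i j
  fin_cases i <;> fin_cases j <;> simp

omit [Valued K ℤᵐ⁰] [ValuativeRel K] [(Valued.v : Valuation K ℤᵐ⁰).Compatible] in
include hJ in
/-- An element of `U` with matrix `d(ϖ, 1, (σϖ)⁻¹)` lies in the torus `T`. [cite: Rogawski1990, §1.10 p. 9] -/
theorem mem_torusU_of_coe_eq_diagonal (hσσ : ∀ x, σ (σ x) = x) (hϖ0 : ϖ ≠ 0) (a : ↥(unitaryGroupOfForm σ J))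
    (ha : ((a : GL (Fin 3) K) : Matrix (Fin 3) (Fin 3) K) = Matrix.diagonal ![ϖ, 1, (σ ϖ)⁻¹]) : a ∈ torusU σ J := by
  obtain ⟨a', ha'T, ha'⟩ := exists_coe_eq_diag σ hJ hσσ hϖ0 (β := 1) (by rw [map_one, mul_one])
  have h : a = a' := by
    apply Subtype.ext; apply Units.ext
    rw [ha, ha']
    ext i j; fin_cases i <;> fin_cases j <;> simp
  rw [h]; exact ha'T

omit [Valued K ℤᵐ⁰] [ValuativeRel K] [(Valued.v : Valuation K ℤᵐ⁰).Compatible] in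
/-- **Powers of the ray**: `a^k` has matrix `d(ϖ^k, 1, (σϖ)⁻ᵏ)`. [cite: Rogawski1990, §1.10 p. 9] -/
theorem coe_pow_eq_diagonal (a : ↥(unitaryGroupOfForm σ J))
    (ha : ((a : GL (Fin 3) K) : Matrix (Fin 3) (Fin 3) K) = Matrix.diagonal ![ϖ, 1, (σ ϖ)⁻¹]) (k : ℕ) :
    (((a ^ k : ↥(unitaryGroupOfForm σ J)) : GL (Fin 3) K) : Matrix (Fin 3) (Fin 3) K) = Matrix.diagonal ![ϖ ^ k, 1, (σ ϖ)⁻¹ ^ k] := by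
  induction k with
  | zero =>
    rw [pow_zero, Subgroup.coe_one, Units.val_one, pow_zero, pow_zero]
    ext i j; fin_cases i <;> fin_cases j <;> simp
  | succ k ih =>
    rw [pow_succ, Subgroup.coe_mul, Units.val_mul, ih, ha, Matrix.diagonal_mul_diagonal]
    ext i j; fin_cases i <;> fin_cases j <;> simp [pow_succ]

include hJ in
/-- **Inverting the ray costs only `K₀`**: `a⁻¹ = w₀ · a · (w₀ · e)` with `e = d(ε, 1, ε)`, `ε = σϖ∕ϖ` a unit (`|σϖ| = |ϖ|`), so
`w₀, w₀ e ∈ K₀`; hence `a⁻ᵏ ∈ K₀ aᵏ K₀`. [cite: Rogawski1990, §1.10 p. 9] [cite: BruhatTits1972, (4.4.3)] -/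
theorem exists_inv_pow_eq (hσσ : ∀ x, σ (σ x) = x) (hσv : ∀ x, Valued.v (σ x) = Valued.v x) (hϖ0 : ϖ ≠ 0)
    (a : ↥(unitaryGroupOfForm σ J)) (ha : ((a : GL (Fin 3) K) : Matrix (Fin 3) (Fin 3) K) = Matrix.diagonal ![ϖ, 1, (σ ϖ)⁻¹]) (k : ℕ) :
    ∃ k₁ ∈ (glInt 3 K).comap (unitaryGroupOfForm σ J).subtype, ∃ k₂ ∈ (glInt 3 K).comap (unitaryGroupOfForm σ J).subtype,
      (a ^ k)⁻¹ = k₁ * a ^ k * k₂ := by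
  have hσϖ0 : σ ϖ ≠ 0 := (map_ne_zero σ).2 hϖ0
  -- the unit `ε = σϖ / ϖ` and the correction `e = d(ε, 1, ε) = d(ε, 1, (σε)⁻¹)`
  have hε0 : σ ϖ * ϖ⁻¹ ≠ 0 := mul_ne_zero hσϖ0 (inv_ne_zero hϖ0)
  obtain ⟨e, heT, he⟩ := exists_coe_eq_diag σ hJ hσσ hε0 (β := 1) (by rw [map_one, mul_one])
  have hσε : (σ (σ ϖ * ϖ⁻¹))⁻¹ = σ ϖ * ϖ⁻¹ := by
    rw [map_mul, map_inv₀, hσσ]; field_simp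
  rw [hσε] at he
  have heK : (e : GL (Fin 3) K) ∈ glInt 3 K := by
    have hvε : Valued.v (σ ϖ * ϖ⁻¹) = 1 := by
      rw [map_mul, map_inv₀, hσv, mul_inv_cancel₀ ((Valuation.ne_zero_iff _).2 hϖ0)]
    refine mem_glInt_of_coe_eq σ hJ hσv he fun i j => ?_
    fin_cases i <;> fin_cases j <;> simp [hvε]
  -- `a⁻¹ = w₀ a w₀ e`
  have haT : a ∈ torusU σ J := mem_torusU_of_coe_eq_diagonal σ hJ hσσ hϖ0 a ha
  have hinv : a⁻¹ = weylLongU σ hJ * a * weylLongU σ hJ * e := by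
    rw [eq_comm, ← mul_inv_eq_one, inv_inv]
    apply Subtype.ext; apply Units.ext
    simp only [Subgroup.coe_mul, Subgroup.coe_one, Units.val_mul, Units.val_one]
    rw [coe_coe_weylLongU_three, ha, he, diagonal_three_eq']
    simp only [Matrix.mul_fin_three]
    ext i j
    fin_cases i <;> fin_cases j <;> simp <;> field_simp
  -- powers: `(w₀ a w₀ e)^k = w₀ a^k w₀ e^k`
  have hwaw : weylLongU σ hJ * a * weylLongU σ hJ ∈ torusU σ J := by
    refine (mem_torusU_iff _).2 ⟨![(Units.mk0 (σ ϖ) hσϖ0)⁻¹, 1, Units.mk0 ϖ hϖ0], Units.ext ?_⟩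
    rw [coe_glDiagonal, Subgroup.coe_mul, Subgroup.coe_mul, Units.val_mul, Units.val_mul, coe_coe_weylLongU_three, ha,
      diagonal_three_eq']
    simp only [Matrix.mul_fin_three]
    ext i j
    fin_cases i <;> fin_cases j <;> simp
  have hcomm : Commute (weylLongU σ hJ * a * weylLongU σ hJ) e := mul_comm_of_mem_torusU σ hwaw heT
  have hconjpow : ∀ m : ℕ, (weylLongU σ hJ * a * weylLongU σ hJ) ^ m = weylLongU σ hJ * a ^ m * weylLongU σ hJ := by
    intro m
    induction m with
    | zero => rw [pow_zero, pow_zero, mul_one, weylLongU_mul_weylLongU]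
    | succ m ih =>
      rw [pow_succ, ih, pow_succ,
        show weylLongU σ hJ * a ^ m * weylLongU σ hJ * (weylLongU σ hJ * a * weylLongU σ hJ) =
          weylLongU σ hJ * a ^ m * (weylLongU σ hJ * weylLongU σ hJ) * a * weylLongU σ hJ by group,
        weylLongU_mul_weylLongU, mul_one]
      simp only [mul_assoc]
  have hpow : (a ^ k)⁻¹ = weylLongU σ hJ * a ^ k * weylLongU σ hJ * e ^ k := by
    rw [← inv_pow, hinv, hcomm.mul_pow, hconjpow]
  refine ⟨weylLongU σ hJ, weylLongU_mem_comap_glInt σ hJ, weylLongU σ hJ * e ^ k,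
    Subgroup.mul_mem _ (weylLongU_mem_comap_glInt σ hJ) (Subgroup.pow_mem _ heK k), ?_⟩
  rw [hpow]; group

omit [ValuativeRel K] [(Valued.v : Valuation K ℤᵐ⁰).Compatible] in
/-- Every non-zero `x` has `v x = exp(e)` for some `e ∈ ℤ` (★ private twin in `UnitaryGroupRogawskiTorusCartanForm`). [cite: Serre1979, Ch. I §1] -/
private theorem exists_v_eq_exp'' {x : K} (hx : x ≠ 0) : ∃ e : ℤ, Valued.v x = WithZero.exp e :=
  ⟨_, (WithZero.exp_log ((Valuation.ne_zero_iff _).2 hx)).symm⟩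

include hJ in
/-- **`T ⊂ K₀ · a^ℕ · K₀ · Z(U)`**: a torus element `diag(d₀, d₁, d₂)` is `(d₁ · 1) · d(γ, 1, (σγ)⁻¹)` with `d₁ · 1` CENTRAL
(`|d₁| = 1`) and `γ = u ϖ^{∓p}` (`|u| = 1`), so `d(γ, 1, (σγ)⁻¹) = a^{±p} · d(u, 1, (σu)⁻¹)` and a negative power is turned
positive by `exists_inv_pow_eq`. [cite: BruhatTits1972, (4.4.3)] [cite: Rogawski1990, §1.10 p. 9] -/
theorem exists_torus_eq_pow (hσσ : ∀ x, σ (σ x) = x) (hσv : ∀ x, Valued.v (σ x) = Valued.v x)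
    (hϖ : Valued.v ϖ = WithZero.exp (-1 : ℤ))
    (a : ↥(unitaryGroupOfForm σ J)) (ha : ((a : GL (Fin 3) K) : Matrix (Fin 3) (Fin 3) K) = Matrix.diagonal ![ϖ, 1, (σ ϖ)⁻¹])
    {t : ↥(unitaryGroupOfForm σ J)} (ht : t ∈ torusU σ J) :
    ∃ k₁ ∈ (glInt 3 K).comap (unitaryGroupOfForm σ J).subtype, ∃ k₂ ∈ (glInt 3 K).comap (unitaryGroupOfForm σ J).subtype,
      ∃ p : ℕ, ∃ z ∈ Subgroup.center ↥(unitaryGroupOfForm σ J), t = k₁ * a ^ p * k₂ * z := by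
  have hϖ0 : ϖ ≠ 0 := fun h => by rw [h, map_zero] at hϖ; exact WithZero.zero_ne_coe hϖ
  have hσϖ0 : σ ϖ ≠ 0 := (map_ne_zero σ).2 hϖ0
  obtain ⟨d, htM, hd20, hd11, hd02⟩ := exists_coe_eq_diagonal_of_mem_torusU σ hJ ht
  -- the central part `z = d₁ · 1`
  obtain ⟨z, hz, -, hzM⟩ := exists_coe_eq_scalar_mem_center σ hJ hσσ hd11
  have hd1 : (d 1 : K) ≠ 0 := (d 1).ne_zero
  -- `γ = d₀ / d₁ = u ϖ^{-e}` with `|u| = 1`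
  have hγ0 : (d 0 : K) * (d 1 : K)⁻¹ ≠ 0 := mul_ne_zero (d 0).ne_zero (inv_ne_zero hd1)
  obtain ⟨e, he⟩ := exists_v_eq_exp'' hγ0
  set u : K := (d 0 : K) * (d 1 : K)⁻¹ * ϖ ^ e with hu
  have hvu : Valued.v u = 1 := by
    rw [hu, map_mul, map_zpow₀, he, hϖ, ← WithZero.exp_zsmul, smul_eq_mul, mul_neg, mul_one, ← WithZero.exp_add,
      add_neg_cancel, WithZero.exp_zero]
  have hu0 : u ≠ 0 := fun h => by rw [h, map_zero] at hvu; exact zero_ne_one hvu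
  obtain ⟨ku, hkuT, hku⟩ := exists_coe_eq_diag σ hJ hσσ hu0 (β := 1) (by rw [map_one, mul_one])
  have hkuK : (ku : GL (Fin 3) K) ∈ glInt 3 K := by
    refine mem_glInt_of_coe_eq σ hJ hσv hku fun i j => ?_
    fin_cases i <;> fin_cases j <;> simp [hvu, hσv]
  -- key scalar identities
  have hσd1 : σ (d 1 : K) = (d 1 : K)⁻¹ := eq_inv_of_mul_eq_one_left hd11
  have hd2 : (d 2 : K) = (σ (d 0 : K))⁻¹ := eq_inv_of_mul_eq_one_right hd02
  rcases le_or_gt e 0 with he0 | he0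
  · -- `e ≤ 0`: `γ = ϖ^p u` with `e = -p`, `t = 1 · a^p · ku · z`
    obtain ⟨p, hp⟩ := Int.exists_eq_neg_ofNat he0
    refine ⟨1, Subgroup.one_mem _, ku, hkuK, p, z, hz, ?_⟩
    have hzc : z * (a ^ p * ku) = a ^ p * ku * z := (Subgroup.mem_center_iff.1 hz _).symm
    rw [one_mul, ← hzc]
    apply Subtype.ext; apply Units.ext
    rw [Subgroup.coe_mul, Subgroup.coe_mul, Units.val_mul, Units.val_mul, htM, hzM, coe_pow_eq_diagonal σ a ha, hku,
      diagonal_three_eq']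
    have hϖp : ϖ ^ p ≠ 0 := pow_ne_zero _ hϖ0
    have h0 : (d 0 : K) = (d 1 : K) * (ϖ ^ p * u) := by
      rw [hu, hp, _root_.zpow_neg, zpow_natCast]; field_simp
    have h2 : (d 2 : K) = (d 1 : K) * (((σ ϖ) ^ p)⁻¹ * (σ u)⁻¹) := by
      rw [hd2, h0, map_mul, map_mul, map_pow, hσd1, mul_inv, inv_inv, mul_inv]
    simp only [Matrix.mul_fin_three]
    ext i j
    fin_cases i <;> fin_cases j <;> simp <;> first | exact h0 | exact h2
  · -- `e > 0`: `γ = ϖ^{-p} u` with `e = p`, `t = (a^p)⁻¹ · ku · z` and `(a^p)⁻¹ = k₁ a^p k₂`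
    obtain ⟨p, hp⟩ := Int.eq_ofNat_of_zero_le he0.le
    obtain ⟨k₁, hk₁, k₂, hk₂, hinv⟩ := exists_inv_pow_eq σ hJ hσσ hσv hϖ0 a ha p
    refine ⟨k₁, hk₁, k₂ * ku, Subgroup.mul_mem _ hk₂ hkuK, p, z, hz, ?_⟩
    have hzc : z * ((a ^ p)⁻¹ * ku) = (a ^ p)⁻¹ * ku * z := (Subgroup.mem_center_iff.1 hz _).symm
    have ht' : t = z * ((a ^ p)⁻¹ * ku) := by
      apply Subtype.ext; apply Units.ext
      rw [Subgroup.coe_mul, Subgroup.coe_mul, Subgroup.coe_inv, Units.val_mul, Units.val_mul, htM, hzM, hku]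
      have hinvM : ((((a ^ p : ↥(unitaryGroupOfForm σ J)) : GL (Fin 3) K)⁻¹ : GL (Fin 3) K) : Matrix (Fin 3) (Fin 3) K) =
          !![(ϖ ^ p)⁻¹, 0, 0; 0, 1, 0; 0, 0, (σ ϖ) ^ p] := by
        ext i j
        rw [inv_apply_of_mem σ hJ, coe_pow_eq_diagonal σ a ha, Matrix.diagonal_apply]
        fin_cases i <;> fin_cases j <;> simp [rev1', rev2', map_pow, map_inv₀, hσσ]
      rw [hinvM]
      have hϖp : ϖ ^ p ≠ 0 := pow_ne_zero _ hϖ0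
      have h0 : (d 0 : K) = (d 1 : K) * ((ϖ ^ p)⁻¹ * u) := by
        rw [hu, hp, zpow_natCast]; field_simp
      have h2 : (d 2 : K) = (d 1 : K) * ((σ ϖ) ^ p * (σ u)⁻¹) := by
        rw [hd2, h0, map_mul, map_mul, map_inv₀, map_pow, hσd1, mul_inv, inv_inv, mul_inv, inv_inv]
      simp only [Matrix.mul_fin_three]
      ext i j
      fin_cases i <;> fin_cases j <;> simp <;> first | exact h0 | exact h2
    rw [ht', hzc, hinv]; group

end Ray

/-! ## §2 THE CARTAN DECOMPOSITION -/

section Cartan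

variable {K : Type*} [Field K] [Valued K ℤᵐ⁰] [ValuativeRel K] [(Valued.v : Valuation K ℤᵐ⁰).Compatible]
  (σ : K →+* K) {J : Matrix (Fin 3) (Fin 3) K} (hJ : J = (StdForm.antidiagonal 3).over K) {ϖ : K}

include hJ in
/-- **THE CARTAN DECOMPOSITION OF THE QUASI-SPLIT `U(3)` FOR ANY ISOMETRIC INVOLUTION** — ramified quadratic `K/K^σ` and residue
characteristic `2` INCLUDED.  For `σ` an involution of `K` preserving the valuation, `ϖ` ANY uniformiser of `K` (not necessarily
`σ`-fixed) and `a = d(ϖ, 1, (σϖ)⁻¹) ∈ U = U(σ, Φ₃)(K)`: every `g ∈ U` is `k₁ aⁿ k₂ z` with `k₁, k₂ ∈ K₀ = U ∩ GL₃(𝒪)`, `n ≥ 0`, `z`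
central — i.e. `U = ⋃ₙ K₀ aⁿ K₀ · Z(U)`, exactly the «Cartan-type exhaustion» consumed by ★
`Representation.isSupercuspidal_of_subsingleton_coinvariants_of_cartan` and ★ `isSupercuspidal_of_coinvariants_subsingleton_of_cartan_diagonal`.
PROOF (elementary, no Bruhat–Tits theory): Iwasawa `g = k (n t)` (`exists_glInt_mul_borel` + ★ `exists_unipotent_mul_torus_of_mem_borelOfForm`),
`n t ∈ K₀ T K₀` (`exists_unipotent_mul_torus_eq`, via the rank-one big cell), `T ⊂ K₀ a^ℕ K₀ Z` (`exists_torus_eq_pow`).  For unramified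
`K/K^σ` this recovers ★ `exists_comap_glInt_mul_torus_mul`; the point is the RAMIFIED case, where no `σ`-fixed uniformiser exists and the
`σ`-fixed ray `d(ϖ_F, 1, ϖ_F⁻¹)` has defect `2`. [cite: BruhatTits1972, (4.4.3)] [cite: Tits1979, §3.3.3] [cite: Casselman1995, Prop. 1.3.1; Thm. 5.3.1]
[cite: Rogawski1990, §1.10 p. 9] -/
theorem exists_cartan_of_involution (hσσ : ∀ x, σ (σ x) = x) (hσv : ∀ x, Valued.v (σ x) = Valued.v x)
    (hϖ : Valued.v ϖ = WithZero.exp (-1 : ℤ))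
    (a : ↥(unitaryGroupOfForm σ J)) (ha : ((a : GL (Fin 3) K) : Matrix (Fin 3) (Fin 3) K) = Matrix.diagonal ![ϖ, 1, (σ ϖ)⁻¹])
    (g : ↥(unitaryGroupOfForm σ J)) :
    ∃ k₁ ∈ (glInt 3 K).comap (unitaryGroupOfForm σ J).subtype, ∃ k₂ ∈ (glInt 3 K).comap (unitaryGroupOfForm σ J).subtype,
      ∃ n : ℕ, ∃ z ∈ Subgroup.center ↥(unitaryGroupOfForm σ J), g = k₁ * a ^ n * k₂ * z := by
  -- Iwasawa `g = k b`
  obtain ⟨k, hk, b, hb, hgb⟩ := exists_glInt_mul_borel σ hJ hσσ hσv g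
  -- Levi `b = n t`
  obtain ⟨u, hu, d, hdT, -, hbud⟩ := exists_unipotent_mul_torus_of_mem_borelOfForm (σ := σ) (N := 3)
    ((mem_borelU_iff_mem_borelOfForm hJ b).1 hb)
  have huU : u ∈ unitaryGroupOfForm σ J := by rw [hJ]; exact hu.1
  have hdU : glDiagonal 3 K d ∈ unitaryGroupOfForm σ J := by rw [hJ]; exact hdT.1
  have hn : (⟨u, huU⟩ : ↥(unitaryGroupOfForm σ J)) ∈ unipotentU σ J := hu.2
  have ht : (⟨glDiagonal 3 K d, hdU⟩ : ↥(unitaryGroupOfForm σ J)) ∈ torusU σ J := ⟨d, rfl⟩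
  have hbnt : b = (⟨u, huU⟩ : ↥(unitaryGroupOfForm σ J)) * ⟨glDiagonal 3 K d, hdU⟩ := Subtype.ext hbud
  -- `n t ∈ K₀ T K₀` and `T ⊂ K₀ a^ℕ K₀ Z`
  obtain ⟨k₁, hk₁, t', ht', k₂, hk₂, hnt⟩ := exists_unipotent_mul_torus_eq σ hJ hσσ hσv ht hn
  obtain ⟨k₃, hk₃, k₄, hk₄, p, z, hz, ht'eq⟩ := exists_torus_eq_pow σ hJ hσσ hσv hϖ a ha ht'
  refine ⟨k * k₁ * k₃, Subgroup.mul_mem _ (Subgroup.mul_mem _ hk hk₁) hk₃, k₄ * k₂, Subgroup.mul_mem _ hk₄ hk₂, p, z, hz, ?_⟩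
  have hzc : k₂ * z = z * k₂ := Subgroup.mem_center_iff.1 hz k₂
  calc g = k * (k₁ * (k₃ * a ^ p * k₄ * z) * k₂) := by rw [hgb, hbnt, hnt, ht'eq]
    _ = k * k₁ * k₃ * a ^ p * k₄ * (z * k₂) := by group
    _ = k * k₁ * k₃ * a ^ p * k₄ * (k₂ * z) := by rw [hzc]
    _ = k * k₁ * k₃ * a ^ p * (k₄ * k₂) * z := by group

end Cartan

end UnitaryGroup

end Literature.NumberTheory.Automorphic
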